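import Literature.Probability.FitznerVanDerHofstad2017.SrwIntegralBounds
import HarnessLib

/-!
# `x`-uniform bounds for the SRW integrals `K_{n,l}(x)`, `I_{n,l}(x)` of the NoBLE analysis:
# `K_{n,l}(x) ≤ K_{n,l}(0)` and `|I_{n,l}(x)| ≤ K_{n,l}(0)` for EVERY `x`

CITATION HEADER. This module is part of a certified REPRODUCTION of:
R. Fitzner, R. van der Hofstad, *Generalized approach to the non-backtracking lace expansion*,
Probab. Theory Related Fields **169** (2017) 1041–1119 [NoBLE17] (arXiv:1506.07969), §3.3.3 and
§5.2, as consumed by *Mean-field behavior for nearest-neighbor percolation in `d > 10`*, Electron.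
J. Probab. **22** (2017) no. 43 [FvdH17]; the SRW-integral toolkit is an adaptation of T. Hara,
G. Slade, *The lace expansion for self-avoiding walk in five or more dimensions*, Rev. Math. Phys.
**4** (1992) 235–327 [HS92b], App. B.1. Reproduces: the suprema (5.26) `sup_{x ∈ S} K_{n,l}(x)`,
`sup_{x ∈ S} I_{n,l}(x)` over an ARBITRARY set of vertices `S`, bounded by the `x = 0` values via
the elementary inequality `|D̂^{(x)}(k)| ≤ 1 = D̂^{(0)}(k)` ((3.34); `abs_DhatSym_le_one`,
`DhatSym_zero` of `SrwIntegralBounds.lean`) and the printed `x = 0` rule (5.14). Origin: build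
`lace`, literature seat (gen 4), for the finding "KSUP" of that build (which `x`-suprema of
`K_{n,l}` the printed toolkit actually licenses).

## What is proved, and why

[NoBLE17] needs `sup_{x ∈ S} K_{n,l}(x)` and `sup_{x ∈ S} I_{n,l}(x)` for infinite `S` ((5.26),
p. 1094) and obtains them from bounds "in terms of `I_{n,l}(x)`, `L_n(x)` and `V_{n,l}`" plus the
monotonicity Lemma 5.1 (= [HS92b] Lemmas B.3–B.4, which are printed for `I_{n,0}` and `L_n`). The
following bounds need NO monotonicity input and hold for every `x ∈ ℤ^d` (`d ≥ 2n + 1`, the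
integrability range):

* `srwK_le_srwK_zero` : `K_{n,l}(x) ≤ K_{n,l}(0)` — since `0 ≤ |D̂|^l Ĉⁿ` and `|D̂^{(x)}| ≤ 1`;
* `abs_srwI_le_srwK` : `|I_{n,l}(x)| ≤ K_{n,l}(x)`, hence `abs_srwI_le_srwK_zero` :
  `|I_{n,l}(x)| ≤ K_{n,l}(0)`;
* with (5.14) (`srwK_zero_even`, `srwK_zero_odd_le`): `srwK_le_srwI_zero_of_even` :
  `K_{n,2j}(x) ≤ I_{n,2j}(0)`, `srwK_le_sqrt_of_odd` : `K_{n,2j+1}(x) ≤ I_{n,2j}(0)^{1/2} I_{n,2j+2}(0)^{1/2}`,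
  and `abs_srwI_le_srwI_zero_of_even` : `|I_{n,2j}(x)| ≤ I_{n,2j}(0)` (the relation
  "`sup_x I_{n,m}(x) = I_{n,m}(0)` for all `m` even" used in R. Fitzner's thesis (5.1.12));
* with the polynomial-majorant lever (`srwK_zero_le_of_majorant`): `srwK_le_of_majorant` : for any
  real polynomial `P = Σ_{j ≤ N} p_j t^j` with `|t|^m ≤ P(t)` on `[-1,1]`, `K_{n,m}(x) ≤ Σ_j p_j I_{n,j}(0)`
  for EVERY `x` — so every certified majorant bound for `K_{n,m}(0)` (module
  `SrwIntegralMajorants.lean`) is an `x`-uniform bound as it stands.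

Combined with the Cauchy–Schwarz bound (5.9) (`srwK_le_sqrt_srwI_mul_srwL`, `x`-dependent through
`L_n(x)`, which is monotone in `x` by [HS92b] Lemma B.4), a user bounds `sup_{x ∈ S} K_{n,l}(x)` by
`min` of the two printed bounds: `srwK_le_min`; and `sup_{x ∈ S} |I_{n,l}(x)|` by
`abs_srwI_le_sqrt_srwI_mul_srwL` / `abs_srwI_le_srwK_zero`.

## References

* [NoBLE17] R. Fitzner, R. van der Hofstad, PTRF 169 (2017) 1041–1119: (3.34)–(3.36) p. 1071;
  §5.2, (5.9) p. 1091, (5.14) p. 1092, (5.26) and Lemma 5.1 p. 1094 (bib key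
  `FitznerVanDerHofstad2016NoBLE`).
* [HS92b] T. Hara, G. Slade, Rev. Math. Phys. 4 (1992) 235–327, App. B.1: (B.24)–(B.27),
  Lemmas B.2–B.4 (`HaraSlade1992b`).
* R. Fitzner, *Non-backtracking lace expansion*, PhD thesis, TU Eindhoven (2013), (5.1.12) p. 231
  (`Fitzner2013Thesis`).
-/

noncomputable section

open MeasureTheory Real Finset
open scoped BigOperators

namespace Literature.Probability.FitznerVanDerHofstad2017

open Literature.Barriers.CriticalPhenomena
open Literature.Barriers.CriticalPhenomena.Slade2006Prop53 (P)

variable {d : ℕ}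

/-! ### `K_{n,l}(x) ≤ K_{n,l}(0)` -/

/-- **`x`-uniform bound**: `K_{n,l}(x) ≤ K_{n,l}(0)` for every `x ∈ ℤ^d` (`d ≥ 2n + 1`), because the
integrand of `K_{n,l}(x)` is `|D̂|^l Ĉⁿ |D̂^{(x)}| ≤ |D̂|^l Ĉⁿ = |D̂|^l Ĉⁿ |D̂^{(0)}|` pointwise
(`|D̂^{(x)}(k)| ≤ 1`, an average of cosines, and `D̂^{(0)} ≡ 1`). In particular
`sup_{x ∈ S} K_{n,l}(x) ≤ K_{n,l}(0)` for every set of vertices `S` in (5.26).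
[cite: FitznerVanDerHofstad2016NoBLE, (3.34) and (3.36) p. 1071; (5.26) p. 1094] -/
theorem srwK_le_srwK_zero {n : ℕ} (hd : 2 * n + 1 ≤ d) (l : ℕ) (x : Fin d → ℤ) :
    srwK d n l x ≤ srwK d n l 0 := by
  unfold srwK
  refine div_le_div_of_nonneg_right ?_ (two_pi_pow_pos d).le
  refine integral_mono_of_nonneg (ae_of_all _ fun k => ?_) (integrable_srwK_integrand hd l 0)
    (ae_of_all _ fun k => ?_)
  · exact mul_nonneg (mul_nonneg (pow_nonneg (abs_nonneg _) l) (abs_nonneg _))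
      (pow_nonneg (Chat_one_nonneg k) n)
  · have h1 : |DhatSym d x k| ≤ |DhatSym d 0 k| := by
      rw [DhatSym_zero, abs_one]
      exact abs_DhatSym_le_one x k
    exact mul_le_mul_of_nonneg_right
      (mul_le_mul_of_nonneg_left h1 (pow_nonneg (abs_nonneg _) l))
      (pow_nonneg (Chat_one_nonneg k) n)

/-- `|I_{n,l}(x)| ≤ K_{n,l}(x)` (`d ≥ 2n + 1`): the integrand of `I_{n,l}(x)` is bounded in absolute
value by that of `K_{n,l}(x)`. [cite: FitznerVanDerHofstad2016NoBLE, (3.35)–(3.36) p. 1071] -/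
theorem abs_srwI_le_srwK {n : ℕ} (hd : 2 * n + 1 ≤ d) (l : ℕ) (x : Fin d → ℤ) :
    |srwI d n l x| ≤ srwK d n l x := by
  unfold srwI srwK
  rw [abs_div, abs_of_pos (two_pi_pow_pos d)]
  refine div_le_div_of_nonneg_right ?_ (two_pi_pow_pos d).le
  refine (abs_integral_le_integral_abs).trans ?_
  refine integral_mono_of_nonneg (ae_of_all _ fun k => abs_nonneg _)
    (integrable_srwK_integrand hd l x) (ae_of_all _ fun k => ?_)
  show |(Dhat d k ^ l * DhatSym d x k) * Chat d 1 k ^ n| ≤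
    (|Dhat d k| ^ l * |DhatSym d x k|) * Chat d 1 k ^ n
  rw [abs_mul, abs_mul, abs_pow, abs_of_nonneg (pow_nonneg (Chat_one_nonneg k) n)]

/-- **`x`-uniform bound for `I`**: `|I_{n,l}(x)| ≤ K_{n,l}(0)` for every `x` (`d ≥ 2n + 1`).
[cite: FitznerVanDerHofstad2016NoBLE, (3.35)–(3.36) p. 1071; (5.26) p. 1094] -/
theorem abs_srwI_le_srwK_zero {n : ℕ} (hd : 2 * n + 1 ≤ d) (l : ℕ) (x : Fin d → ℤ) :
    |srwI d n l x| ≤ srwK d n l 0 :=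
  (abs_srwI_le_srwK hd l x).trans (srwK_le_srwK_zero hd l x)

/-! ### Combined with the `x = 0` rule (5.14) -/

/-- `l = 2j` even: `K_{n,2j}(x) ≤ I_{n,2j}(0)` for every `x` (`d ≥ 2n + 1`).
[cite: FitznerVanDerHofstad2016NoBLE, (5.14) p. 1092; (5.26) p. 1094] -/
theorem srwK_le_srwI_zero_of_even {n : ℕ} (hd : 2 * n + 1 ≤ d) (j : ℕ) (x : Fin d → ℤ) :
    srwK d n (2 * j) x ≤ srwI d n (2 * j) 0 :=
  (srwK_le_srwK_zero hd _ x).trans (srwK_zero_even n j).le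

/-- `l = 2j + 1` odd: `K_{n,2j+1}(x) ≤ I_{n,2j}(0)^{1/2} I_{n,2j+2}(0)^{1/2}` for every `x`
(`d ≥ 2n + 1`; (5.14)-odd = [HS92b] (B.24) at `x = 0`, made `x`-uniform).
[cite: FitznerVanDerHofstad2016NoBLE, (5.14) p. 1092; (5.26) p. 1094] -/
theorem srwK_le_sqrt_of_odd {n : ℕ} (hd : 2 * n + 1 ≤ d) (j : ℕ) (x : Fin d → ℤ) :
    srwK d n (2 * j + 1) x ≤
      Real.sqrt (srwI d n (2 * j) 0) * Real.sqrt (srwI d n (2 * j + 2) 0) :=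
  (srwK_le_srwK_zero hd _ x).trans (srwK_zero_odd_le hd j)

/-- `l = 2j` even: `|I_{n,2j}(x)| ≤ I_{n,2j}(0)` for every `x` (`d ≥ 2n + 1`) — the relation
"`sup_x I_{n,m}(x) = I_{n,m}(0)` for all `m` even" (R. Fitzner's thesis, (5.1.12)), which thus
needs no monotonicity in `x`. [cite: Fitzner2013Thesis, (5.1.12) p. 231]
[cite: FitznerVanDerHofstad2016NoBLE, (5.14) p. 1092] -/
theorem abs_srwI_le_srwI_zero_of_even {n : ℕ} (hd : 2 * n + 1 ≤ d) (j : ℕ) (x : Fin d → ℤ) :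
    |srwI d n (2 * j) x| ≤ srwI d n (2 * j) 0 :=
  (abs_srwI_le_srwK_zero hd _ x).trans (srwK_zero_even n j).le

/-- **Polynomial majorants are `x`-uniform**: if `|t|^m ≤ Σ_{j ≤ N} p_j t^j` on `[-1,1]`, then
`K_{n,m}(x) ≤ Σ_{j ≤ N} p_j I_{n,j}(0)` for EVERY `x` (`d ≥ 2n + 1`). Hence each certified
majorant bound for `K_{n,m}(0)` bounds `sup_x K_{n,m}(x)`. [folklore]
[cite: FitznerVanDerHofstad2016NoBLE, (5.14) p. 1092; (5.26) p. 1094] -/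
theorem srwK_le_of_majorant {n : ℕ} (hd : 2 * n + 1 ≤ d) (m : ℕ) (x : Fin d → ℤ) (N : ℕ)
    (p : ℕ → ℝ)
    (hP : ∀ t ∈ Set.Icc (-1 : ℝ) 1, |t| ^ m ≤ ∑ j ∈ Finset.range (N + 1), p j * t ^ j) :
    srwK d n m x ≤ ∑ j ∈ Finset.range (N + 1), p j * srwI d n j 0 :=
  (srwK_le_srwK_zero hd m x).trans (srwK_zero_le_of_majorant hd m N p hP)

/-- Monotonised form: for `l ≤ l'`, `K_{n,l'}(x) ≤ K_{n,l}(0)` for every `x` (`d ≥ 2n + 1`), so a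
bound established for `K_{n,l}(0)` serves every larger exponent and every vertex. [folklore] -/
theorem srwK_le_srwK_zero_of_le {n : ℕ} (hd : 2 * n + 1 ≤ d) (x : Fin d → ℤ) {l l' : ℕ}
    (h : l ≤ l') : srwK d n l' x ≤ srwK d n l 0 :=
  (srwK_anti hd x h).trans (srwK_le_srwK_zero hd l x)

/-! ### The valid `x`-dependent bound for `|I_{n,l}(x)|` via (5.9) and the monotone `L_n` -/

/-- **`|I_{n,l}(x)| ≤ [I_{n,2l}(0) L_n(x)]^{1/2}`** for every `x` (`d ≥ 2n + 1`): `|I| ≤ K` and the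
Cauchy–Schwarz bound (5.9). Since `L_n` is monotone in `x` in the sense of [HS92b] Lemma B.4
(printed and proved there), this is the printed-toolkit route to `sup_{x ∈ S} |I_{n,l}(x)|` over an
infinite `S` that does not use the `I_{n,l}`-clause of [NoBLE17] Lemma 5.1 for `l ≥ 1` (which
[HS92b] Lemma B.3 states for `l = 0` only); combine with `abs_srwI_le_srwK_zero` by `le_min`.
[cite: FitznerVanDerHofstad2016NoBLE, (3.35)–(3.36) p. 1071, (5.9) p. 1091, (5.26) p. 1094]
[cite: HaraSlade1992b, App. B.1, (B.25)–(B.27), Lemma B.4] -/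
theorem abs_srwI_le_sqrt_srwI_mul_srwL {n : ℕ} (hd : 2 * n + 1 ≤ d) (l : ℕ) (x : Fin d → ℤ) :
    |srwI d n l x| ≤ Real.sqrt (srwI d n (2 * l) 0) * Real.sqrt (srwL d n x) :=
  (abs_srwI_le_srwK hd l x).trans (srwK_le_sqrt_srwI_mul_srwL hd l x)

/-- The two printed bounds together: for every `x`,
`K_{n,l}(x) ≤ min (K_{n,l}(0), [I_{n,2l}(0) L_n(x)]^{1/2})` (`d ≥ 2n + 1`).
[cite: FitznerVanDerHofstad2016NoBLE, (5.9) p. 1091, (5.14) p. 1092, (5.26) p. 1094] -/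
theorem srwK_le_min {n : ℕ} (hd : 2 * n + 1 ≤ d) (l : ℕ) (x : Fin d → ℤ) :
    srwK d n l x ≤ min (srwK d n l 0) (Real.sqrt (srwI d n (2 * l) 0) * Real.sqrt (srwL d n x)) :=
  le_min (srwK_le_srwK_zero hd l x) (srwK_le_sqrt_srwI_mul_srwL hd l x)

end Literature.Probability.FitznerVanDerHofstad2017

end
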